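import Literature.MathematicalPhysics.QuantumFieldTheory.BalabanImbrieJaffe1984to88.BIJ88Eq536Linearization

/-!
# `BalabanImbrieJaffe1984to88.BIJ88ContourSupport536` — T. Bałaban, J. Imbrie, A. Jaffe, *Effective action and cluster properties of the
abelian Higgs model*, Commun. Math. Phys. **114** (1988) 257–315 [BalabanImbrieJaffe1988], **(5.3.1)/(5.3.6)** p. 280 [PDF 24] with [2] = T. Bałaban,
J. Imbrie, A. Jaffe, *Renormalization of the Higgs model: minimizers, propagators and the stability of mean field theory*, Commun. Math. Phys.
**97** (1985) 299–329 [BalabanImbrieJaffe1985], **(2.10)–(2.13)** pp. 303–304 and **(2.17)** p. 304: **THE CONTOURS OF THE BLOCK AVERAGE (2.10)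
OVER A BLOCK BOND `c` SEE ONLY THE BONDS NEAR `c`** — locality of the linearized average, the LOCAL small-field linearization of (2.10)
(p31's `BIJ88Eq536Linearization.qU_phaseField` with its loop hypothesis discharged from bounds on the bonds near `c` only), the Lie-algebra
surface field `Q^{s*}w` with `L·(average of Q^{s*}w) = w`, and linearity of the average — the geometric inputs of the interior chart law of
Sect. 5.12 (this seat's `BIJ88FreeCoordinates48`, hypotheses `hlin`, `hbd`, `hQS`), ON THE TORUS OF RECORD.

statement-level skeleton of published theorems with citation tags; proofs where landed; nothing here is a claim about the Yang–Mills mass gap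

THE PRINT (verbatim).  [2] p. 303: *"define Q on gauge fields on the unit lattice by (Qu)_{yy′} = u(Γ_{yy′}) exp[L^{−d} Σ_{x∈B(y)} ln u(Γ_{yx} ∘
Γ_{xx′} ∘ Γ_{y′x′}^{−1} ∘ Γ_{y′y})]. (2.10) In (2.10) choose the logarithm so that −π ≦ arg ln u < π. (2.11)"*; p. 304: *"(QA)_{b′} = L^{−(d+1)}
Σ_{x∈B(b′₋)} Σ_{b∈Γ_{xx′}} A_b, (2.13) … Thus the bonds b which enter the sum (2.13) range over the interior of the two L-blocks B(b′₋) and B(b′₊)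
as well as the (surface) bonds connecting these blocks."* and *"Let us define an operator Q^{s*} as a map … (Q^{s*}B)_b = B_{b′} if b ∈ B^s(b′), 0
otherwise … (2.17)"* and p. 305 *"Furthermore, by (2.13), QQ^{s*} = I (2.19)"*.
[BalabanImbrieJaffe1988] p. 280: *"As in (3.24) we put u = u′(Λ₁^{(k)*}Q^{s*}v), (5.3.1) … we obtain
that u′_b = e^{ie_kA′_b} with |A′_b| ≦ cp(e_k), for b ∈ Λ₁^{(k)*}."*

WHAT IS PROVED (0 `sorry`; no `Prop`-valued fact; standard axioms; carriers all of record: r18's `BIJ85BlockAveragesTorus` (`qU`, blocks,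
corners, comb legs `legBond`, straight runs `runBond`, `IsCross`, `coarse`), p31's `BIJ88Eq536Linearization` (`phaseField`, `legSum`, `combSum`,
`runSumL`, `loopSum`, `combAvg`, `qU_phaseField`), r18's axial trees `IsAxialBond`; standing range `j + 1 ≤ m + K`).
 §1 `Near c b` — *"the bonds b which enter … range over the interior of the two L-blocks B(b′₋) and B(b′₊) as well as the (surface) bonds
    connecting these blocks"*: `b` starts in `B(c₋) ∪ B(c₊)` and crosses a face only through the face of `c`; every bond of the contours of
    (2.10) over `c` is near `c` (`near_legBond`, `near_runBond`), hence the loop, the comb/run sums and the full linear average over `c` depend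
    on `θ` only through its values near `c` (`loopSum_congr_near`, `combAvg_congr_near`).
 §2 THE LOCAL SMALL-FIELD REGIME: `|θ_b| ≤ τ` on the bonds near `c` and `2(d+1)Lτ < π` put every loop over `c` in the principal branch
    (`loopSum_mem_Ico_near`) and bound `|L·combAvg θ c| ≤ 2(d+1)Lτ` (`abs_mul_combAvg_le_near`); **`qU_phaseField_near`**: the linearization
    `(Qe^{iθ})_c = e^{iL·combAvg θ c}` under these LOCAL hypotheses (the interior integral of (5.12.3) only controls the fields near `Λ₁₀`).
 §3 `sfA w` = `Q^{s*}w` in the Lie algebra; `runSumL_sfA` (a straight run picks up exactly one surface term), `combSum_sfA = 0` (tree bonds never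
    cross), **`mul_combAvg_sfA`: `L·combAvg (Q^{s*}w) c = w_c`** ((2.19) `QQ^{s*} = I` for the full contour average).
 §4 linearity of the full average (`combAvg_add`, `combAvg_smul`, `combAvgL`, `combAvg_sub`).
HONEST SCOPE.  Pure lattice geometry and finite sums; no measure, no bound on fields beyond the displayed ones; the factor `L` is the length of
the `L`-lattice bond in unit bonds (p31's convention `qU (phaseField θ) c = expU1 (L * combAvg θ c)`).  Seat p34 gen 12, file G5a (own lineage;
TAKING line HOME/STATUS.md 2026-08-22T07:19Z).

CITATION HEADER (lean-in-tree rule).  Part of the lit-balaban TYPED SKELETON (HOME `run/shared/lean/pub/lit-balaban/`), PHASE-2 proof seat p34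
gen 12 (unit `lit-balaban-p34-g12`).  Rows served: support for **`C2.Eq5.12.8`** (G-C2-23: the torus instantiation of this seat's
`BIJ88FreeCoordinates48.chartLaw` — hypotheses `hlin`/`hbd` via `qU_phaseField_near`/`abs_mul_combAvg_le_near`, `hQS` via `mul_combAvg_sfA`) and
`C2.Eq5.3.1-5.3.7` (owner r16; the local form of p31's linearization), xref `C1.Eq2.13`/`C1.Eq2.17` (owner r15).  PDFs held:
`paper:balaban1988-cmp114-bij-abelian-higgs-effective-action` (journal page = PDF page + 256), `paper:balaban1985-cmp97-bij-higgs-minimizers` (journal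
page = PDF page + 298).
-/

namespace Literature.MathematicalPhysics.QuantumFieldTheory.BalabanImbrieJaffe1984to88.BIJ88ContourSupport536

open Literature.MathematicalPhysics.QuantumFieldTheory.Balaban1983to89
open BIJ88Sect3Statements (U1)
open BIJ88RenormTransf311 (inBlock IsAxialBond)
open BIJ85BlockAveragesTorus (qU expU1 corner blockOf_corner legSite legBond blockOf_legSite isAxialBond_legBond runSite runBond
  runSite_eq_blockSite_hi blockOf_runSite_lo blockOf_runSite_L inBlock_runSite_lo inBlock_runSite_hi IsCross coarse mem_block_iff)
open BIJ88Eq536Linearization (phaseField legSum combSum runSumL loopSum combAvg qU_phaseField not_isCross_of_isAxialBond abs_combSum_le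
  abs_runSumL_le loopSum_mem_Ico)
open scoped BigOperators Real
open Finset

noncomputable section

variable {P : Params} {j : ℕ}

/-! ## §1 The bonds seen by the contours of a block bond -/

/-- **The bonds NEAR the block bond `c = ⟨y, y + e_μ⟩`**: unit bonds starting in `B(y) ∪ B(y + e_μ)` which, if they cross a block face, cross
the face of `c` (`b ∈ B^s(c)`).  Every bond of the contours `Γ_{yx}`, `Γ_{xx′}`, `Γ_{y′x′}`, `Γ_{yy′}` of (2.10), `x ∈ B(y)`, is near `c`
(`near_legBond`, `near_runBond`). [cite: BalabanImbrieJaffe1985, (2.10) p.303] -/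
def Near (c : PBond P (j+1)) (b : PBond P j) : Prop :=
  (blockOf b.src = c.src ∨ blockOf b.src = c.src.shift c.dir) ∧ (IsCross b → coarse b = c)

/-- kernel: nearness to a block bond is decidable. [cite: BalabanImbrieJaffe1985, (2.10) p.303] -/
instance instDecidablePredNear (c : PBond P (j+1)) : DecidablePred (Near c) := fun b => by
  unfold Near; infer_instance

/-- kernel: the bonds of a comb leg `Γ_{yx}` inside `B(c₋)` or `B(c₊)` are near `c` (they stay in their block and are tree bonds, never
crossing; standing range). [cite: BalabanImbrieJaffe1985, (2.4) p.302] -/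
theorem near_legBond (hj : j + 1 ≤ P.m + P.K) {c : PBond P (j+1)} {x : Balaban1983to89.Site P j}
    (hx : blockOf x = c.src ∨ blockOf x = c.src.shift c.dir) {μ : Fin P.d} {t : ℕ} (ht : t < inBlock x μ) : Near c (legBond x μ t) := by
  have hL : inBlock x μ < P.L := Nat.mod_lt _ P.L_pos
  refine ⟨?_, fun hcr => absurd hcr (not_isCross_of_isAxialBond (isAxialBond_legBond hj ht))⟩
  have hb : blockOf (legBond x μ t).src = blockOf x := blockOf_legSite hj x μ ⟨t, lt_trans ht hL⟩
  rw [hb]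
  exact hx

/-- kernel: the bonds of the straight run `Γ_{xx′}` from `x ∈ B(c₋)` in the direction of `c` are near `c`: the first part stays in `B(c₋)`
and crosses the face of `c` exactly at `t = L − 1 − n_μ(x)`, the second part lies in `B(c₊)` and crosses nothing (standing range).
[cite: BalabanImbrieJaffe1985, (2.10) p.303] -/
theorem near_runBond (hj : j + 1 ≤ P.m + P.K) {c : PBond P (j+1)} {x : Balaban1983to89.Site P j} (hx : blockOf x = c.src) {t : ℕ}
    (ht : t < P.L) : Near c (runBond x c.dir t) := by
  have hL : inBlock x c.dir < P.L := Nat.mod_lt _ P.L_pos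
  by_cases hlo : inBlock x c.dir + t < P.L
  · refine ⟨Or.inl (by rw [show (runBond x c.dir t).src = runSite x c.dir t from rfl, blockOf_runSite_lo hj x c.dir hlo, hx]), fun _ => ?_⟩
    show (⟨blockOf (runSite x c.dir t), c.dir⟩ : PBond P (j+1)) = c
    rw [blockOf_runSite_lo hj x c.dir hlo, hx]
  · have ht1 : P.L ≤ inBlock x c.dir + t := by omega
    refine ⟨Or.inr ?_, fun hcr => ?_⟩
    · show blockOf (runSite x c.dir t) = _
      rw [runSite_eq_blockSite_hi hj x c.dir ht1 ht.le, Balaban1983to89.Site.blockOf_blockSite hj, hx]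
    · exfalso
      unfold IsCross at hcr
      rw [show (runBond x c.dir t).src = runSite x c.dir t from rfl, show (runBond x c.dir t).dir = c.dir from rfl,
        inBlock_runSite_hi hj x c.dir ht1 ht.le] at hcr
      omega

variable {θ₁ θ₂ : PBond P j → ℝ}

/-- kernel: `θ(Γ_{yx})` only sees the bonds near `c` (`x` in one of the two blocks of `c`). [cite: BalabanImbrieJaffe1985, (2.4) p.302] -/
theorem combSum_congr_near (hj : j + 1 ≤ P.m + P.K) {c : PBond P (j+1)} {x : Balaban1983to89.Site P j}
    (hx : blockOf x = c.src ∨ blockOf x = c.src.shift c.dir) (h : ∀ b, Near c b → θ₁ b = θ₂ b) : combSum θ₁ x = combSum θ₂ x := by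
  unfold combSum legSum
  exact sum_congr rfl fun μ _ => sum_congr rfl fun t ht => h _ (near_legBond hj hx (mem_range.1 ht))

/-- kernel: `θ(Γ_{xx′})` only sees the bonds near `c` (`x ∈ B(c₋)`, direction of `c`). [cite: BalabanImbrieJaffe1985, (2.13) p.304] -/
theorem runSumL_congr_near (hj : j + 1 ≤ P.m + P.K) {c : PBond P (j+1)} {x : Balaban1983to89.Site P j} (hx : blockOf x = c.src)
    (h : ∀ b, Near c b → θ₁ b = θ₂ b) : runSumL θ₁ x c.dir = runSumL θ₂ x c.dir := by
  unfold runSumL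
  exact sum_congr rfl fun t ht => h _ (near_runBond hj hx (mem_range.1 ht))

/-- **The loop of (2.10) only sees the bonds near its block bond.** [cite: BalabanImbrieJaffe1985, (2.10) p.303] -/
theorem loopSum_congr_near (hj : j + 1 ≤ P.m + P.K) {c : PBond P (j+1)} {x : Balaban1983to89.Site P j} (hx : x ∈ block c.src)
    (h : ∀ b, Near c b → θ₁ b = θ₂ b) : loopSum θ₁ c x = loopSum θ₂ c x := by
  have hy : blockOf x = c.src := mem_block_iff.1 hx
  have hy' : blockOf (runSite x c.dir P.L) = c.src.shift c.dir := by rw [blockOf_runSite_L hj, hy]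
  unfold loopSum
  rw [combSum_congr_near hj (Or.inl hy) h, runSumL_congr_near hj hy h, combSum_congr_near hj (Or.inr hy') h,
    runSumL_congr_near hj (blockOf_corner hj c.src) h]

/-- **The full linear average of (2.10) over `c` only sees the bonds near `c`.** [cite: BalabanImbrieJaffe1985, (2.13) p.304] -/
theorem combAvg_congr_near (hj : j + 1 ≤ P.m + P.K) {c : PBond P (j+1)} (h : ∀ b, Near c b → θ₁ b = θ₂ b) :
    combAvg θ₁ c = combAvg θ₂ c := by
  unfold combAvg
  congr 1
  refine sum_congr rfl fun x hx => ?_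
  have hy : blockOf x = c.src := mem_block_iff.1 hx
  have hy' : blockOf (runSite x c.dir P.L) = c.src.shift c.dir := by rw [blockOf_runSite_L hj, hy]
  rw [combSum_congr_near hj (Or.inl hy) h, runSumL_congr_near hj hy h, combSum_congr_near hj (Or.inr hy') h]

/-! ## §2 The LOCAL small-field regime: bounds and the linearization with hypotheses on the bonds near `c` only -/

/-- the truncation of a Lie-algebra field to the bonds near `c`. [cite: BalabanImbrieJaffe1985, (2.10) p.303] -/
def truncNear (c : PBond P (j+1)) (θ : PBond P j → ℝ) : PBond P j → ℝ := fun b => if Near c b then θ b else 0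

/-- kernel: the truncation agrees with the field on the bonds near `c`. [cite: BalabanImbrieJaffe1985, (2.10) p.303] -/
theorem truncNear_of_near {c : PBond P (j+1)} (θ : PBond P j → ℝ) {b : PBond P j} (hb : Near c b) : truncNear c θ b = θ b := by
  simp [truncNear, hb]

/-- kernel: the truncation is globally bounded by the local bound. [cite: BalabanImbrieJaffe1985, (2.10) p.303] -/
theorem abs_truncNear_le {c : PBond P (j+1)} {θ : PBond P j → ℝ} {τ : ℝ} (hτ : 0 ≤ τ) (hθ : ∀ b, Near c b → |θ b| ≤ τ) (b : PBond P j) :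
    |truncNear c θ b| ≤ τ := by
  unfold truncNear
  split_ifs with hb
  · exact hθ b hb
  · simpa using hτ

/-- kernel: `|L·(full average of θ over c)| ≤ 2(d+1)Lτ` for `|θ_b| ≤ τ` everywhere (`2d(L−1) + L ≤ 2(d+1)L` bonds per contour triple, `L^d`
sites, prefactor `L^{−(d+1)}`; standing range). [cite: BalabanImbrieJaffe1985, (2.13) p.304] -/
theorem abs_mul_combAvg_le (hj : j + 1 ≤ P.m + P.K) {θ : PBond P j → ℝ} {τ : ℝ} (hθ : ∀ b, |θ b| ≤ τ) (c : PBond P (j+1)) :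
    |(P.L : ℝ) * combAvg θ c| ≤ 2 * ((P.d : ℝ) + 1) * P.L * τ := by
  have hτ : 0 ≤ τ := (abs_nonneg _).trans (hθ (runBond (corner c.src) c.dir 0))
  have hL : (0 : ℝ) < P.L := by exact_mod_cast P.L_pos
  have hd : (0 : ℝ) ≤ P.d := Nat.cast_nonneg _
  have hterm : ∀ x ∈ block c.src, |combSum θ x + runSumL θ x c.dir - combSum θ (runSite x c.dir P.L)| ≤ 2 * ((P.d : ℝ) + 1) * P.L * τ := by
    intro x _
    have h1 := abs_combSum_le hθ x
    have h2 := abs_runSumL_le hθ x c.dir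
    have h3 := abs_combSum_le hθ (runSite x c.dir P.L)
    calc |combSum θ x + runSumL θ x c.dir - combSum θ (runSite x c.dir P.L)|
        ≤ |combSum θ x| + |runSumL θ x c.dir| + |combSum θ (runSite x c.dir P.L)| :=
          (abs_sub _ _).trans (add_le_add (abs_add_le _ _) le_rfl)
      _ ≤ (P.d : ℝ) * ((P.L - 1 : ℝ) * τ) + P.L * τ + (P.d : ℝ) * ((P.L - 1 : ℝ) * τ) := by linarith
      _ ≤ 2 * ((P.d : ℝ) + 1) * P.L * τ := by nlinarith
  have hsum : |∑ x ∈ block c.src, (combSum θ x + runSumL θ x c.dir - combSum θ (runSite x c.dir P.L))|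
      ≤ (P.L : ℝ) ^ P.d * (2 * ((P.d : ℝ) + 1) * P.L * τ) := by
    refine (abs_sum_le_sum_abs _ _).trans ((sum_le_sum hterm).trans ?_)
    rw [sum_const, Balaban1983to89.Site.card_block hj, nsmul_eq_mul]
    push_cast
    exact le_rfl
  unfold combAvg
  rw [← mul_assoc, abs_mul]
  have hpre : |(P.L : ℝ) * ((P.L : ℝ) ^ (P.d + 1))⁻¹| = ((P.L : ℝ) ^ P.d)⁻¹ := by
    rw [abs_of_pos (by positivity), pow_succ]
    field_simp
  rw [hpre]
  calc ((P.L : ℝ) ^ P.d)⁻¹ * |∑ x ∈ block c.src, (combSum θ x + runSumL θ x c.dir - combSum θ (runSite x c.dir P.L))|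
      ≤ ((P.L : ℝ) ^ P.d)⁻¹ * ((P.L : ℝ) ^ P.d * (2 * ((P.d : ℝ) + 1) * P.L * τ)) :=
        mul_le_mul_of_nonneg_left hsum (by positivity)
    _ = 2 * ((P.d : ℝ) + 1) * P.L * τ := by field_simp

/-- **LOCAL loop bound**: `θ(loop) ∈ [−π, π)` for every loop of (2.10) over `c` as soon as `|θ_b| ≤ τ` on the bonds NEAR `c` and
`2(d+1)Lτ < π`. [cite: BalabanImbrieJaffe1988, (5.3.1) p.280] -/
theorem loopSum_mem_Ico_near (hj : j + 1 ≤ P.m + P.K) {θ : PBond P j → ℝ} {c : PBond P (j+1)} {τ : ℝ} (hτ0 : 0 ≤ τ)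
    (hθ : ∀ b, Near c b → |θ b| ≤ τ) (hτ : 2 * ((P.d : ℝ) + 1) * P.L * τ < π) {x : Balaban1983to89.Site P j} (hx : x ∈ block c.src) :
    loopSum θ c x ∈ Set.Ico (-π) π := by
  rw [← loopSum_congr_near hj hx (fun b hb => truncNear_of_near θ hb)]
  exact loopSum_mem_Ico (abs_truncNear_le hτ0 hθ) hτ c x

/-- **LOCAL bound on the linear average**: `|L·(full average of θ over c)| ≤ 2(d+1)Lτ` for `|θ_b| ≤ τ` on the bonds near `c`.
[cite: BalabanImbrieJaffe1985, (2.13) p.304] -/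
theorem abs_mul_combAvg_le_near (hj : j + 1 ≤ P.m + P.K) {θ : PBond P j → ℝ} {c : PBond P (j+1)} {τ : ℝ} (hτ0 : 0 ≤ τ)
    (hθ : ∀ b, Near c b → |θ b| ≤ τ) : |(P.L : ℝ) * combAvg θ c| ≤ 2 * ((P.d : ℝ) + 1) * P.L * τ := by
  rw [← combAvg_congr_near hj (fun b hb => truncNear_of_near θ hb)]
  exact abs_mul_combAvg_le hj (abs_truncNear_le hτ0 hθ) c

/-- **THE LINEARIZATION OF (2.10) IN THE LOCAL SMALL-FIELD REGIME**: for `θ_b ∈ [−π, π)` everywhere and `|θ_b| ≤ τ` on the bonds near `c`,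
`2(d+1)Lτ < π`: `(Q e^{iθ})_c = exp(i·L·(full linear average of θ over c))` — p31's `qU_phaseField` with its loop hypothesis discharged
locally. [cite: BalabanImbrieJaffe1985, (2.13) p.304] -/
theorem qU_phaseField_near (hj : j + 1 ≤ P.m + P.K) {θ : PBond P j → ℝ} (hθ : ∀ b, θ b ∈ Set.Ico (-π) π) {c : PBond P (j+1)}
    {τ : ℝ} (hτ0 : 0 ≤ τ) (hnear : ∀ b, Near c b → |θ b| ≤ τ) (hτ : 2 * ((P.d : ℝ) + 1) * P.L * τ < π) :
    qU (phaseField θ) c = expU1 (P.L * combAvg θ c) :=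
  qU_phaseField hj hθ fun _ hx => loopSum_mem_Ico_near hj hτ0 hnear hτ hx

/-! ## §3 Additive surface fields: `Q^{s*}w` in the Lie algebra and `L·(average of Q^{s*}w) = w` -/

/-- **`Q^{s*}w` in the Lie algebra**: `w_{c(b)}` on the surface bonds, `0` elsewhere (the additive form of r18's `surfFactor`).
[cite: BalabanImbrieJaffe1988, (5.12.4) p.301] -/
def sfA (w : PBond P (j+1) → ℝ) (b : PBond P j) : ℝ := if IsCross b then w (coarse b) else 0

/-- kernel: `Q^{s*}w` on a surface bond. [cite: BalabanImbrieJaffe1988, (5.12.4) p.301] -/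
theorem sfA_of_isCross (w : PBond P (j+1) → ℝ) {b : PBond P j} (hb : IsCross b) : sfA w b = w (coarse b) := by simp [sfA, hb]
/-- kernel: `Q^{s*}w` off the surface bonds. [cite: BalabanImbrieJaffe1988, (5.12.4) p.301] -/
theorem sfA_of_not_isCross (w : PBond P (j+1) → ℝ) {b : PBond P j} (hb : ¬ IsCross b) : sfA w b = 0 := by simp [sfA, hb]

/-- kernel: along the straight run from `x`, `Q^{s*}w` is `w_{⟨B(x), μ⟩}` at the crossing bond `t = L − 1 − n_μ(x)` and `0` elsewhere (the
additive twin of r18's `surfFactor_runBond`). [cite: BalabanImbrieJaffe1985, (3.9) p.307] -/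
theorem sfA_runBond (hj : j + 1 ≤ P.m + P.K) (w : PBond P (j+1) → ℝ) (x : Balaban1983to89.Site P j) (μ : Fin P.d) {t : ℕ}
    (ht : t < P.L) : sfA w (runBond x μ t) = if t = P.L - 1 - inBlock x μ then w ⟨blockOf x, μ⟩ else 0 := by
  have hlt : inBlock x μ < P.L := Nat.mod_lt _ P.L_pos
  unfold sfA IsCross coarse
  simp only [runBond]
  by_cases hlo : inBlock x μ + t < P.L
  · rw [inBlock_runSite_lo hj x μ hlo, blockOf_runSite_lo hj x μ hlo]
    by_cases he : t = P.L - 1 - inBlock x μ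
    · rw [if_pos (by omega), if_pos he]
    · rw [if_neg (by omega), if_neg he]
  · rw [inBlock_runSite_hi hj x μ (by omega) ht.le, if_neg (by omega), if_neg (by omega)]

/-- **`Q^{s*}w(Γ_{xx′}) = w_{⟨B(x), μ⟩}`** — the straight run picks up exactly one surface term. [cite: BalabanImbrieJaffe1985, (3.10) p.307] -/
theorem runSumL_sfA (hj : j + 1 ≤ P.m + P.K) (w : PBond P (j+1) → ℝ) (x : Balaban1983to89.Site P j) (μ : Fin P.d) :
    runSumL (sfA w) x μ = w ⟨blockOf x, μ⟩ := by
  have hlt : inBlock x μ < P.L := Nat.mod_lt _ P.L_pos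
  unfold runSumL
  rw [sum_congr rfl fun t ht => sfA_runBond hj w x μ (mem_range.1 ht), sum_ite_eq', if_pos (mem_range.2 (by omega))]

/-- kernel: `Q^{s*}w` vanishes along the comb legs (tree bonds never cross). [cite: BalabanImbrieJaffe1985, (3.4) p.306] -/
theorem combSum_sfA (hj : j + 1 ≤ P.m + P.K) (w : PBond P (j+1) → ℝ) (x : Balaban1983to89.Site P j) : combSum (sfA w) x = 0 := by
  unfold combSum legSum
  refine sum_eq_zero fun μ _ => sum_eq_zero fun t ht => ?_
  exact sfA_of_not_isCross w (not_isCross_of_isAxialBond (isAxialBond_legBond hj (mem_range.1 ht)))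

/-- **`L·(full average of Q^{s*}w over c) = w_c`** — the Lie-algebra form of `QQ^{s*} = I` ([2] (2.19) p. 305, *"by (2.13)"*) for the full
contour average of (2.10) (standing range). [cite: BalabanImbrieJaffe1985, (2.19) p.305] -/
theorem mul_combAvg_sfA (hj : j + 1 ≤ P.m + P.K) (w : PBond P (j+1) → ℝ) (c : PBond P (j+1)) : (P.L : ℝ) * combAvg (sfA w) c = w c := by
  have hL : (P.L : ℝ) ≠ 0 := Nat.cast_ne_zero.mpr P.L_pos.ne'
  unfold combAvg
  have hx : ∀ x ∈ block c.src, combSum (sfA w) x + runSumL (sfA w) x c.dir - combSum (sfA w) (runSite x c.dir P.L) = w c := by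
    intro x hx
    rw [combSum_sfA hj, combSum_sfA hj, runSumL_sfA hj, mem_block_iff.1 hx, zero_add, sub_zero]
  rw [sum_congr rfl hx, sum_const, Balaban1983to89.Site.card_block hj, nsmul_eq_mul]
  push_cast
  field_simp
  ring

/-! ## §4 The full linear average is linear -/

/-- kernel: `θ(Γ_{yx})` is additive in `θ`. [cite: BalabanImbrieJaffe1985, (2.13) p.304] -/
theorem combSum_add (θ₁ θ₂ : PBond P j → ℝ) (x : Balaban1983to89.Site P j) : combSum (θ₁ + θ₂) x = combSum θ₁ x + combSum θ₂ x := by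
  simp only [combSum, legSum, Pi.add_apply, sum_add_distrib]

/-- kernel: `θ(Γ_{xx′})` is additive in `θ`. [cite: BalabanImbrieJaffe1985, (2.13) p.304] -/
theorem runSumL_add (θ₁ θ₂ : PBond P j → ℝ) (x : Balaban1983to89.Site P j) (μ : Fin P.d) :
    runSumL (θ₁ + θ₂) x μ = runSumL θ₁ x μ + runSumL θ₂ x μ := by
  simp only [runSumL, Pi.add_apply, sum_add_distrib]

/-- kernel: `θ(Γ_{yx})` is homogeneous in `θ`. [cite: BalabanImbrieJaffe1985, (2.13) p.304] -/
theorem combSum_smul (t : ℝ) (θ : PBond P j → ℝ) (x : Balaban1983to89.Site P j) : combSum (t • θ) x = t * combSum θ x := by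
  simp only [combSum, legSum, Pi.smul_apply, smul_eq_mul, mul_sum]

/-- kernel: `θ(Γ_{xx′})` is homogeneous in `θ`. [cite: BalabanImbrieJaffe1985, (2.13) p.304] -/
theorem runSumL_smul (t : ℝ) (θ : PBond P j → ℝ) (x : Balaban1983to89.Site P j) (μ : Fin P.d) : runSumL (t • θ) x μ = t * runSumL θ x μ := by
  simp only [runSumL, Pi.smul_apply, smul_eq_mul, mul_sum]

/-- **The full linear average of (2.10) is additive.** [cite: BalabanImbrieJaffe1985, (2.13) p.304] -/
theorem combAvg_add (θ₁ θ₂ : PBond P j → ℝ) (c : PBond P (j+1)) : combAvg (θ₁ + θ₂) c = combAvg θ₁ c + combAvg θ₂ c := by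
  simp only [combAvg, combSum_add, runSumL_add, ← mul_add, ← sum_add_distrib]
  congr 1
  exact sum_congr rfl fun x _ => by ring

/-- **The full linear average of (2.10) is homogeneous.** [cite: BalabanImbrieJaffe1985, (2.13) p.304] -/
theorem combAvg_smul (t : ℝ) (θ : PBond P j → ℝ) (c : PBond P (j+1)) : combAvg (t • θ) c = t * combAvg θ c := by
  simp only [combAvg, combSum_smul, runSumL_smul]
  have h : ∑ x ∈ block c.src, (t * combSum θ x + t * runSumL θ x c.dir - t * combSum θ (runSite x c.dir P.L)) =
      t * ∑ x ∈ block c.src, (combSum θ x + runSumL θ x c.dir - combSum θ (runSite x c.dir P.L)) := by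
    rw [mul_sum]
    exact sum_congr rfl fun x _ => by ring
  rw [h]
  ring

/-- the full linear average over `c` as a linear functional. [cite: BalabanImbrieJaffe1985, (2.13) p.304] -/
def combAvgL (c : PBond P (j+1)) : (PBond P j → ℝ) →ₗ[ℝ] ℝ where
  toFun θ := combAvg θ c
  map_add' θ₁ θ₂ := combAvg_add θ₁ θ₂ c
  map_smul' t θ := combAvg_smul t θ c

/-- kernel: the linear functional is the full average. [cite: BalabanImbrieJaffe1985, (2.13) p.304] -/
@[simp] theorem combAvgL_apply (c : PBond P (j+1)) (θ : PBond P j → ℝ) : combAvgL c θ = combAvg θ c := rfl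

/-- kernel: the full average of a difference. [cite: BalabanImbrieJaffe1985, (2.13) p.304] -/
theorem combAvg_sub (θ₁ θ₂ : PBond P j → ℝ) (c : PBond P (j+1)) : combAvg (θ₁ - θ₂) c = combAvg θ₁ c - combAvg θ₂ c :=
  map_sub (combAvgL c) θ₁ θ₂

/-- kernel: the full average of the zero field vanishes. [cite: BalabanImbrieJaffe1985, (2.13) p.304] -/
theorem combAvg_zero (c : PBond P (j+1)) : combAvg (0 : PBond P j → ℝ) c = 0 := map_zero (combAvgL c)


/-! ## §6 (v1.1) Locality of the block average itself: `(Qu)_c` only sees the bonds near `c` -/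

section GroupLocality

open BIJ85BlockAveragesTorus (holC legProd runC runArg loopC loopAvg)

variable {U U' : GaugeField P j U1}

/-- **`u(Γ_{yx})` only sees the bonds near `c`** (`x` in `B(c₋)` or `B(c₊)`; standing range). [cite: BalabanImbrieJaffe1985, (2.5) p.302] -/
theorem holC_congr_near (hj : j + 1 ≤ P.m + P.K) {c : PBond P (j+1)} {x : Balaban1983to89.Site P j}
    (hx : blockOf x = c.src ∨ blockOf x = c.src.shift c.dir) (h : ∀ b, Near c b → U b = U' b) : holC U x = holC U' x := by
  unfold holC legProd
  exact prod_congr rfl fun μ _ => prod_congr rfl fun t ht => by rw [h _ (near_legBond hj hx (mem_range.1 ht))]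

/-- **`u(Γ_{xx′})` only sees the bonds near `c`** (`x ∈ B(c₋)`, direction of `c`). [cite: BalabanImbrieJaffe1985, (2.10) p.303] -/
theorem runC_congr_near (hj : j + 1 ≤ P.m + P.K) {c : PBond P (j+1)} {x : Balaban1983to89.Site P j} (hx : blockOf x = c.src)
    (h : ∀ b, Near c b → U b = U' b) : runC U x c.dir = runC U' x c.dir := by
  unfold runC
  exact prod_congr rfl fun t ht => by rw [h _ (near_runBond hj hx (mem_range.1 ht))]

/-- kernel: the run phase only sees the bonds near `c`. [cite: BalabanImbrieJaffe1985, (2.11) p.303] -/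
theorem runArg_congr_near (hj : j + 1 ≤ P.m + P.K) {c : PBond P (j+1)} {x : Balaban1983to89.Site P j} (hx : blockOf x = c.src)
    (h : ∀ b, Near c b → U b = U' b) : runArg U x c.dir = runArg U' x c.dir := by
  unfold runArg
  exact sum_congr rfl fun t ht => by rw [h _ (near_runBond hj hx (mem_range.1 ht))]

/-- **The closed contour variable of (2.10) only sees the bonds near `c`.** [cite: BalabanImbrieJaffe1985, (2.10) p.303] -/
theorem loopC_congr_near (hj : j + 1 ≤ P.m + P.K) {c : PBond P (j+1)} {x : Balaban1983to89.Site P j} (hx : x ∈ block c.src)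
    (h : ∀ b, Near c b → U b = U' b) : loopC U c x = loopC U' c x := by
  have hy : blockOf x = c.src := mem_block_iff.1 hx
  have hy' : blockOf (runSite x c.dir P.L) = c.src.shift c.dir := by rw [blockOf_runSite_L hj, hy]
  unfold loopC
  rw [holC_congr_near hj (Or.inl hy) h, runC_congr_near hj hy h, holC_congr_near hj (Or.inr hy') h,
    runC_congr_near hj (blockOf_corner hj c.src) h]

/-- kernel: the averaged loop phase only sees the bonds near `c`. [cite: BalabanImbrieJaffe1985, (2.11) p.303] -/
theorem loopAvg_congr_near (hj : j + 1 ≤ P.m + P.K) {c : PBond P (j+1)} (h : ∀ b, Near c b → U b = U' b) :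
    loopAvg U c = loopAvg U' c := by
  unfold loopAvg
  rw [sum_congr rfl fun x hx => show BIJ85Sect1Model.argB (loopC U c x) = BIJ85Sect1Model.argB (loopC U' c x) by
    rw [loopC_congr_near hj hx h]]

/-- **THE BLOCK AVERAGE `(Qu)_c` OF (2.10) ONLY SEES THE BONDS NEAR `c`** ([2] p. 304: *"the bonds b which enter … range over the interior
of the two L-blocks B(b′₋) and B(b′₊) as well as the (surface) bonds connecting these blocks"*; standing range).
[cite: BalabanImbrieJaffe1985, (2.10) p.303] -/
theorem qU_congr_near (hj : j + 1 ≤ P.m + P.K) {c : PBond P (j+1)} (h : ∀ b, Near c b → U b = U' b) : qU U c = qU U' c := by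
  unfold qU
  rw [runArg_congr_near hj (blockOf_corner hj c.src) h, loopAvg_congr_near hj h]

end GroupLocality

end

end Literature.MathematicalPhysics.QuantumFieldTheory.BalabanImbrieJaffe1984to88.BIJ88ContourSupport536
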